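import Summits.HubbardSuperconductivity.HubbardSuperconductivity.Theorems.BalabanIRBirComplexStableXYRCoulombSandwich
import Summits.HubbardSuperconductivity.HubbardSuperconductivity.Theorems.BalabanIRBirComplexStableXYRStubWindingSectorCost
import HarnessLib

/-!
# Crux `BirComplexStableXYR` (stmt-HubbardSuperconductivity-14845), line `fat-gaussian-defect-calculus`, chapter 2
# §2.1 (sector organisation): LOWER bounds on the Gaussian cost of a sector — holonomy and vortex parts

Support file (prover seat 1, route BalabanIR; continuation of item G2 "Coulomb strain σ_a").

In lead c7's exact Fröhlich–Spencer representation (`FSUnfolding.stub_fsRepresentation`) the sector of a tree-gauge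
integer `1`-cochain `a` carries the Gaussian weight `exp(−(K/2)·𝒬(σ_a))`, `σ_a = 2πa − d₀ψ_a`, `𝒬(ω) = Σ_s Q(P_s ω)` the
thin form.  Stub B5 `FSUnfolding.stub_windingSectorCost` (p159354) bounds the cost of a PURE HOLONOMY sector
(`d₁ a = 0`, `wind a = h`) from ABOVE by `|Λ|·Q(constant twist)`; the line card (§2.1) also uses the LOWER bounds
"spatial holonomy `h₀, h₁` costs `≳ c₀ K h² M`", "temporal holonomy `h₂` costs `≳ c₀ K h₂² L²/M`", which this file
proves, together with the joint vortex + flux lower bound for an arbitrary sector: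

* `scl_sum_sq_harm₁` — flux energy: `Σ_{x,i} (harm₁ ω)(x,i)² = Σ_i (Σ_x ω(x,i))² / |Λ|`;
* `scl_sum_intCast_of_d₁_eq_zero` — for a vortex-free integer cochain, `Σ_x a(x,i) = |Λ|·(wind a i)/N_i`;
* `scl_sum_eq_of_exact_shift` — `Σ_x (2πa − d₀ψ)(x,i) = 2π Σ_x a(x,i)` (class function);
* **`stub_sectorCostLower`** (registered stub): for ANY integer cochain `a` and any strain `σ = 2πa − d₀ψ` of its class,
  `2c₀·(Σ_{x,i} (coexact (d₁(2πa)))(x,i)² + 4π² Σ_i (Σ_x a(x,i))²/|Λ|) ≤ 𝒬(σ)` — Coulomb energy of the vortex current plus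
  flux energy (from `coulombSandwich`'s lower half, which needs no Pythagoras, and Hodge orthogonality
  `TorusChart.sum_sq_coexact_add_harm₁`);
* **`stub_windingSectorCostLower`** (registered stub, the counterpart of B5): for a vortex-free `a` with `wind a = h`,
  `8π²c₀·|Λ|·(h₀²/L² + h₁²/L² + h₂²/M²) ≤ 𝒬(σ)`; on `Λ L M` (`|Λ| = L²M`) this is `8π²c₀(M h₀² + M h₁² + L² h₂²/M)`, i.e.
  the Gaussian weight of a spatial holonomy is `≤ exp(−4π²c₀K·M·h²)` and of a temporal one `≤ exp(−4π²c₀K·L²h₂²/M)`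
  (B5 gives the matching upper bound on the cost, of the same order by `thinForm_le_normSq`).

No definitions; no Pythagoras hypothesis is needed for lower bounds; sorry-free. [folklore: Fröhlich–Spencer, CMP 81
(1981) §3, spin-wave/vortex/flux energy decomposition]
-/

noncomputable section

namespace Summit.HubbardSuperconductivity.HubbardSuperconductivity.Theorems

set_option linter.dupNamespace false -- summit = problem name (single-conjunct summit), D-0017

open scoped BigOperators ComplexConjugate
open Complex Summit.HubbardSuperconductivity.BirComplexStableXYNegative
open Literature.Probability.LatticeModels Literature.MathematicalPhysics.QuantumFieldTheory

section SectorCostLower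

variable {r : ℕ} {L M : ℕ} [NeZero L] [NeZero M]

/-- **Flux energy**: the `ℓ²`-energy of the harmonic (componentwise-mean) part of a `1`-cochain is
`Σ_i (Σ_x ω(x,i))² / |Λ|`. [folklore] -/
theorem scl_sum_sq_harm₁ {Λ' : Type*} [AddCommGroup Λ'] [Fintype Λ'] {d : ℕ} (ω : Λ' → Fin d → ℝ) :
    ∑ x : Λ', ∑ i : Fin d, (TorusChart.harm₁ ω x i) ^ 2
      = ∑ i : Fin d, (∑ x : Λ', ω x i) ^ 2 / (Fintype.card Λ' : ℝ) := by
  have hc : (0 : ℝ) < Fintype.card Λ' := TorusChart.card_pos_real (Λ := Λ')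
  rw [Finset.sum_comm]
  refine Finset.sum_congr rfl fun i _ => ?_
  simp only [TorusChart.harm₁_apply, TorusChart.mean_def, Finset.sum_const, Finset.card_univ, nsmul_eq_mul]
  field_simp

/-- **Cauchy–Schwarz for the flux**: `Σ_i (Σ_x ω(x,i))²/|Λ| ≤ Σ_{x,i} ω(x,i)²`. [folklore] -/
theorem scl_flux_le_sum_sq {Λ' : Type*} [AddCommGroup Λ'] [Fintype Λ'] {d : ℕ} (ω : Λ' → Fin d → ℝ) :
    ∑ i : Fin d, (∑ x : Λ', ω x i) ^ 2 / (Fintype.card Λ' : ℝ) ≤ ∑ x : Λ', ∑ i : Fin d, (ω x i) ^ 2 := by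
  have hc : (0 : ℝ) < Fintype.card Λ' := TorusChart.card_pos_real (Λ := Λ')
  rw [Finset.sum_comm (s := (Finset.univ : Finset Λ'))]
  refine Finset.sum_le_sum fun i _ => ?_
  rw [div_le_iff₀ hc]
  have h := Finset.sum_mul_sq_le_sq_mul_sq (Finset.univ : Finset Λ') (fun x => ω x i) (fun _ => (1 : ℝ))
  simpa [Finset.card_univ] using h

/-- **The total of a strain is a class function**: `Σ_x (ω − d₀ψ)(x,i) = Σ_x ω(x,i)` (gradients have zero total on a
torus). [folklore] -/
theorem scl_sum_sub_d₀ {Λ' : Type*} [AddCommGroup Λ'] [Fintype Λ'] {d : ℕ} (F : TorusChart Λ' d)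
    (ω : Λ' → Fin d → ℝ) (ψ : Λ' → ℝ) (i : Fin d) :
    ∑ x : Λ', (ω x i - F.d₀ ψ x i) = ∑ x : Λ', ω x i := by
  rw [Finset.sum_sub_distrib, F.sum_d₀ ψ i, sub_zero]

/-- `Σ_x (2πa − d₀ψ)(x,i) = 2π · Σ_x a(x,i)` for an integer cochain `a`. [folklore] -/
theorem scl_sum_eq_of_exact_shift {Λ' : Type*} [AddCommGroup Λ'] [Fintype Λ'] {d : ℕ} (F : TorusChart Λ' d)
    (a : Λ' → Fin d → ℤ) (ψ : Λ' → ℝ) (i : Fin d) :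
    ∑ x : Λ', (2 * Real.pi * (a x i : ℝ) - F.d₀ ψ x i) = 2 * Real.pi * ((∑ x : Λ', a x i : ℤ) : ℝ) := by
  rw [scl_sum_sub_d₀ F (fun x i => 2 * Real.pi * (a x i : ℝ)) ψ i, ← Finset.mul_sum, Int.cast_sum]

/-- **Total of a vortex-free integer cochain**: if `d₁ a = 0` then `Σ_x a(x,i) = |Λ| · (wind a i) / N_i` (over `ℝ`,
`2πa` is the constant twist `2π(wind a i)/N_i` plus a gradient, `FSUnfolding.windingSector_exists_d₀`). [folklore] -/
theorem scl_sum_intCast_of_d₁_eq_zero {Λ' : Type*} [AddCommGroup Λ'] [Fintype Λ'] {d : ℕ} (F : TorusChart Λ' d)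
    (a : Λ' → Fin d → ℤ) (ha : F.d₁ a = 0) (i : Fin d) :
    ((∑ x : Λ', a x i : ℤ) : ℝ) = (Fintype.card Λ' : ℝ) * ((F.wind a i : ℤ) : ℝ) / (F.period i : ℝ) := by
  obtain ⟨g, hg⟩ := FSUnfolding.windingSector_exists_d₀ F 1 a ha
  have hsum : ∑ x : Λ', (1 * (a x i : ℝ) - 1 * ((F.wind a i : ℤ) : ℝ) / (F.period i : ℝ)) = ∑ x : Λ', F.d₀ g x i :=
    Finset.sum_congr rfl fun x _ => congrFun (congrFun hg x) i
  rw [F.sum_d₀ g i, Finset.sum_sub_distrib, Finset.sum_const, Finset.card_univ, nsmul_eq_mul, sub_eq_zero] at hsum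
  simp only [one_mul] at hsum
  rw [Int.cast_sum, hsum]
  ring

/-- **Lower bound by the `ℓ²`-energy of the Coulomb representative, without Pythagoras**: for every real cochain
`σ = ω − d₀ψ`, `2c₀ · Σ_{x,i} (coexact (d₁ ω) + harm₁ ω)(x,i)² ≤ 𝒬(σ)` (coercivity `stub_thinFormCoercive` and the
`ℓ²`-minimality of the Coulomb representative, `TorusChart.sum_sq_coexact_add_harm₁_le`). [folklore] -/
theorem scl_coulomb_lower (c : Table r) {c₀ : ℝ} (hr : 2 ≤ r) (hc₀ : 0 < c₀)
    (hA : c.sum (fun _ a => a) = 0)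
    (hC : ∀ φ : W r → ℝ, c₀ * ∑ w, ∑ w', (1 - Real.cos (φ w - φ w')) ≤ (genF c φ).re)
    (P : (Λ L M → Fin 3 → ℝ) → Λ L M → W r → ℝ)
    (hP : ∀ (ω : Λ L M → Fin 3 → ℝ) (s : Λ L M) (w : W r), P ω s w =
      (TorusChart.piProdZMod 2 L M).lineSum ω 0 (w.1 : ℕ) s
        + (TorusChart.piProdZMod 2 L M).lineSum ω 1 (w.2.1 : ℕ) (s + (w.1 : ℕ) • (TorusChart.piProdZMod 2 L M).gen 0)
        + (TorusChart.piProdZMod 2 L M).lineSum ω 2 (w.2.2 : ℕ)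
          (s + (w.1 : ℕ) • (TorusChart.piProdZMod 2 L M).gen 0 + (w.2.1 : ℕ) • (TorusChart.piProdZMod 2 L M).gen 1))
    (Q : (W r → ℝ) → ℝ) (hQ : ∀ u : W r → ℝ, Q u = (-c.sum (fun n a => a * (((∑ w, (n w : ℝ) * u w) ^ 2 : ℝ) : ℂ))).re)
    (ω σ : Λ L M → Fin 3 → ℝ) (ψ : Λ L M → ℝ)
    (hσ : σ = fun x i => ω x i - (TorusChart.piProdZMod 2 L M).d₀ ψ x i) :
    2 * c₀ * ∑ x : Λ L M, ∑ i : Fin 3, ((TorusChart.piProdZMod 2 L M).coexact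
        ((TorusChart.piProdZMod 2 L M).d₁ ω) x i + TorusChart.harm₁ ω x i) ^ 2 ≤ ∑ s : Λ L M, Q (P σ s) := by
  set F := TorusChart.piProdZMod 2 L M with hF
  have hcoer := FSUnfolding.stub_thinFormCoercive r c c₀ hr hc₀ hA hC L M σ
  have hQP : ∀ s : Λ L M, Q (P σ s)
      = (-c.sum (fun n a => a * (((∑ w : W r, (n w : ℝ) *
          (F.lineSum σ 0 (w.1 : ℕ) s + F.lineSum σ 1 (w.2.1 : ℕ) (s + (w.1 : ℕ) • F.gen 0)
            + F.lineSum σ 2 (w.2.2 : ℕ) (s + (w.1 : ℕ) • F.gen 0 + (w.2.1 : ℕ) • F.gen 1))) ^ 2 : ℝ) : ℂ))).re := by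
    intro s
    rw [hQ]
    simp only [hP]
  rw [← Finset.sum_congr rfl fun s _ => hQP s] at hcoer
  have hmin := F.sum_sq_coexact_add_harm₁_le ω ψ
  have hσ2 : ∑ x : Λ L M, ∑ i : Fin 3, (ω x i - F.d₀ ψ x i) ^ 2 = ∑ x : Λ L M, ∑ i : Fin 3, (σ x i) ^ 2 := by
    simp only [hσ]
  rw [hσ2] at hmin
  have h2 : 0 ≤ 2 * c₀ := by positivity
  exact (mul_le_mul_of_nonneg_left hmin h2).trans hcoer

/-- **Registered stub `stub_sectorCostLower` (prover seat 1 on stmt-HubbardSuperconductivity-14845; chapter 2 §2.1):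
joint vortex + flux lower bound on the Gaussian cost of an arbitrary sector.**  For a table with `Σ c_n = 0` and
coercivity (C) at range `r ≥ 2`, on `Λ L M`, in lead c7's notation: for EVERY integer `1`-cochain `a` and every
strain `σ = 2πa − d₀ψ` of its class,
`2c₀ · (Σ_{x,i} (coexact (d₁ (2πa)))(x,i)² + 4π² Σ_i (Σ_x a(x,i))² / |Λ|) ≤ Σ_s Q(P σ)`:
the Coulomb energy of the vortex current (`= ½⟨d₁(2πa), G d₁(2πa)⟩`, `TorusChart.sum_sq_coexact_d₁`) plus the flux
energy of the class.  Both summands are class functions of `(d₁ a, Σ_x a)`. [folklore] -/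
theorem stub_sectorCostLower : ∀ (r : ℕ) (c : Table r) (c₀ : ℝ), 2 ≤ r → 0 < c₀ → c.sum (fun _ a => a) = 0 → (∀ φ : W r → ℝ, c₀ * ∑ w, ∑ w', (1 - Real.cos (φ w - φ w')) ≤ (genF c φ).re) → ∀ (L M : ℕ) [NeZero L] [NeZero M] (P : (Λ L M → Fin 3 → ℝ) → Λ L M → W r → ℝ), (∀ (ω : Λ L M → Fin 3 → ℝ) (s : Λ L M) (w : W r), P ω s w = (Literature.MathematicalPhysics.QuantumFieldTheory.TorusChart.piProdZMod 2 L M).lineSum ω 0 (w.1 : ℕ) s + (Literature.MathematicalPhysics.QuantumFieldTheory.TorusChart.piProdZMod 2 L M).lineSum ω 1 (w.2.1 : ℕ) (s + (w.1 : ℕ) • (Literature.MathematicalPhysics.QuantumFieldTheory.TorusChart.piProdZMod 2 L M).gen 0) + (Literature.MathematicalPhysics.QuantumFieldTheory.TorusChart.piProdZMod 2 L M).lineSum ω 2 (w.2.2 : ℕ) (s + (w.1 : ℕ) • (Literature.MathematicalPhysics.QuantumFieldTheory.TorusChart.piProdZMod 2 L M).gen 0 + (w.2.1 : ℕ) • (Literature.MathematicalPhysics.QuantumFieldTheory.TorusChart.piProdZMod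 2 L M).gen 1)) → ∀ (Q : (W r → ℝ) → ℝ), (∀ u : W r → ℝ, Q u = (-c.sum (fun n a => a * (((∑ w, (n w : ℝ) * u w) ^ 2 : ℝ) : ℂ))).re) → ∀ (a : Λ L M → Fin 3 → ℤ) (σ : Λ L M → Fin 3 → ℝ), (∃ ψ : Λ L M → ℝ, σ = fun x i => 2 * Real.pi * (a x i : ℝ) - (Literature.MathematicalPhysics.QuantumFieldTheory.TorusChart.piProdZMod 2 L M).d₀ ψ x i) → 2 * c₀ * (∑ x : Λ L M, ∑ i : Fin 3, ((Literature.MathematicalPhysics.QuantumFieldTheory.TorusChart.piProdZMod 2 L M).coexact ((Literature.MathematicalPhysics.QuantumFieldTheory.TorusChart.piProdZMod 2 L M).d₁ (fun x i => 2 * Real.pi * (a x i : ℝ))) x i) ^ 2 + 4 * Real.pi ^ 2 * ∑ i : Fin 3, ((∑ x : Λ L M, a x i : ℤ) : ℝ) ^ 2 / (Fintype.card (Λ L M) : ℝ)) ≤ ∑ s : Λ L M, Q (P σ s) := by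
  intro r c c₀ hr hc₀ hA hC L M _ _ P hP Q hQ a σ hσ
  obtain ⟨ψ, hσ⟩ := hσ
  set F := TorusChart.piProdZMod 2 L M with hF
  set ω : Λ L M → Fin 3 → ℝ := fun x i => 2 * Real.pi * (a x i : ℝ) with hω
  have hlow := scl_coulomb_lower c hr hc₀ hA hC P hP Q hQ ω σ ψ (by rw [hσ])
  rw [F.sum_sq_coexact_add_harm₁ ω, scl_sum_sq_harm₁ ω] at hlow
  have hflux : ∑ i : Fin 3, (∑ x : Λ L M, ω x i) ^ 2 / (Fintype.card (Λ L M) : ℝ)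
      = 4 * Real.pi ^ 2 * ∑ i : Fin 3, ((∑ x : Λ L M, a x i : ℤ) : ℝ) ^ 2 / (Fintype.card (Λ L M) : ℝ) := by
    rw [Finset.mul_sum]
    refine Finset.sum_congr rfl fun i _ => ?_
    have : ∑ x : Λ L M, ω x i = 2 * Real.pi * ((∑ x : Λ L M, a x i : ℤ) : ℝ) := by
      rw [Int.cast_sum, Finset.mul_sum]
    rw [this]
    ring
  rw [hflux] at hlow
  exact hlow

/-- **Registered stub `stub_windingSectorCostLower` (prover seat 1 on stmt-HubbardSuperconductivity-14845; the lower
counterpart of B5 `FSUnfolding.stub_windingSectorCost`): the Gaussian cost of a pure holonomy sector is at least the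
flux energy.**  Same hypotheses as B5 (vortex-free `a`, `wind a = h`, any strain `σ = 2πa − d₀ψ` of its class; the
Pythagoras hypothesis of B5 is not needed): `8π²c₀ · |Λ L M| · (h₀²/L² + h₁²/L² + h₂²/M²) ≤ Σ_s Q(P σ)`.  With
`|Λ L M| = L²M`: a spatial holonomy costs at least `8π²c₀·M·h²` and a temporal one `8π²c₀·L²h₂²/M` in `𝒬`, i.e.
`exp(−(K/2)𝒬(σ)) ≤ exp(−4π²c₀K(M h₀² + M h₁² + L²h₂²/M))`. [folklore] -/
theorem stub_windingSectorCostLower : ∀ (r : ℕ) (c : Table r) (c₀ : ℝ), 2 ≤ r → 0 < c₀ → c.sum (fun _ a => a) = 0 → (∀ φ : W r → ℝ, c₀ * ∑ w, ∑ w', (1 - Real.cos (φ w - φ w')) ≤ (genF c φ).re) → ∀ (L M : ℕ) [NeZero L] [NeZero M] (P : (Λ L M → Fin 3 → ℝ) → Λ L M → W r → ℝ), (∀ (ω : Λ L M → Fin 3 → ℝ) (s : Λ L M) (w : W r), P ω s w = (Literature.MathematicalPhysics.QuantumFieldTheory.TorusChart.piProdZMod 2 L M).lineSum ω 0 (w.1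 : ℕ) s + (Literature.MathematicalPhysics.QuantumFieldTheory.TorusChart.piProdZMod 2 L M).lineSum ω 1 (w.2.1 : ℕ) (s + (w.1 : ℕ) • (Literature.MathematicalPhysics.QuantumFieldTheory.TorusChart.piProdZMod 2 L M).gen 0) + (Literature.MathematicalPhysics.QuantumFieldTheory.TorusChart.piProdZMod 2 L M).lineSum ω 2 (w.2.2 : ℕ) (s + (w.1 : ℕ) • (Literature.MathematicalPhysics.QuantumFieldTheory.TorusChart.piProdZMod 2 L M).gen 0 + (w.2.1 : ℕ) • (Literature.MathematicalPhysics.QuantumFieldTheory.TorusChart.piProdZMod 2 L M).gen 1)) → ∀ (Q : (W r → ℝ) → ℝ), (∀ u : W r → ℝ, Q u = (-c.sum (fun n a => a * (((∑ w, (n w : ℝ) * u w) ^ 2 : ℝ) : ℂ))).re) → ∀ (h : Fin 3 → ℤ) (a : Λ L M → Fin 3 → ℤ), (Literature.MathematicalPhysics.QuantumFieldTheory.TorusChart.piProdZMod 2 L M).d₁ a = 0 → (Literature.MathematicalPhysics.QuantumFieldTheory.TorusChart.piProdZMod 2 L M).wind a = h → ∀ (σ : Λ L M → Fin 3 → ℝ),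 (∃ ψ : Λ L M → ℝ, σ = fun x i => 2 * Real.pi * (a x i : ℝ) - (Literature.MathematicalPhysics.QuantumFieldTheory.TorusChart.piProdZMod 2 L M).d₀ ψ x i) → 8 * Real.pi ^ 2 * c₀ * (Fintype.card (Λ L M) : ℝ) * (((h 0 : ℤ) : ℝ) ^ 2 / (L : ℝ) ^ 2 + ((h 1 : ℤ) : ℝ) ^ 2 / (L : ℝ) ^ 2 + ((h 2 : ℤ) : ℝ) ^ 2 / (M : ℝ) ^ 2) ≤ ∑ s : Λ L M, Q (P σ s) := by
  intro r c c₀ hr hc₀ hA hC L M _ _ P hP Q hQ h a hd₁ hwind σ hσ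
  set F := TorusChart.piProdZMod 2 L M with hF
  have hper0 : F.period 0 = L := TorusChart.piProdZMod_period_castSucc 2 L M 0
  have hper1 : F.period 1 = L := TorusChart.piProdZMod_period_castSucc 2 L M 1
  have hper2 : F.period 2 = M := TorusChart.piProdZMod_period_last 2 L M
  have hmain := stub_sectorCostLower r c c₀ hr hc₀ hA hC L M P hP Q hQ a σ hσ
  -- drop the (nonnegative) Coulomb energy of the current and evaluate the flux
  have hcoex : 0 ≤ ∑ x : Λ L M, ∑ i : Fin 3, (F.coexact (F.d₁ (fun x i => 2 * Real.pi * (a x i : ℝ))) x i) ^ 2 :=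
    Finset.sum_nonneg fun x _ => Finset.sum_nonneg fun i _ => sq_nonneg _
  have hcard : (0 : ℝ) < Fintype.card (Λ L M) := TorusChart.card_pos_real (Λ := Λ L M)
  have hsum : ∀ i : Fin 3, ((∑ x : Λ L M, a x i : ℤ) : ℝ)
      = (Fintype.card (Λ L M) : ℝ) * ((h i : ℤ) : ℝ) / (F.period i : ℝ) := by
    intro i
    rw [scl_sum_intCast_of_d₁_eq_zero F a hd₁ i, hwind]
  have hflux : ∑ i : Fin 3, ((∑ x : Λ L M, a x i : ℤ) : ℝ) ^ 2 / (Fintype.card (Λ L M) : ℝ)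
      = (Fintype.card (Λ L M) : ℝ) * (((h 0 : ℤ) : ℝ) ^ 2 / (L : ℝ) ^ 2 + ((h 1 : ℤ) : ℝ) ^ 2 / (L : ℝ) ^ 2
          + ((h 2 : ℤ) : ℝ) ^ 2 / (M : ℝ) ^ 2) := by
    rw [Fin.sum_univ_three, hsum 0, hsum 1, hsum 2, hper0, hper1, hper2]
    field_simp
  rw [hflux] at hmain
  have h2c : 0 ≤ 2 * c₀ := by positivity
  nlinarith [hmain, mul_nonneg h2c hcoex]

end SectorCostLower

end Summit.HubbardSuperconductivity.HubbardSuperconductivity.Theorems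

end
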